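import Mathlib

/-!
# `DivisionGap.PerMultiplesHard` (stmt-ValiantsHypothesis-5068), line `uncharged-face-walk`:
exponential beats polynomial (stub `stub_eventuallyExp`)

For `C, D ≥ 1` and all large `n`: if `n ≤ C·a`, `a ≤ n`, `a < D·k` and
`16^k ≤ (L+1)² · e^{2(C+1)} · a^{C+1}`, then `2^{⌊n/(C·D)⌋} ≤ L`.

Proof.  Put `m := ⌊n/(C·D)⌋`.  From `n ≤ C·a < C·D·k` we get `m < k`, so `16^{m+1} ≤ 16^k`;
also `n < C·D·(m+1)`, so `a^{C+1} ≤ n^{C+1} ≤ (C·D)^{C+1} (m+1)^{C+1}`.  If `L < 2^m` then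
`(L+1)² ≤ 4^m`, whence `16^{m+1} ≤ 4^m · B · (m+1)^{C+1}` with the constant
`B := e^{2(C+1)} (C·D)^{C+1}`.  But `B · (m+1)^{C+1} < 16 · 4^m` for all large `m`
(polynomial versus exponential growth, `tendsto_pow_const_div_const_pow_of_one_lt`), and
`4^m · 16 · 4^m = 16^{m+1}`: contradiction.  Largeness of `m` follows from `n ≥ C·D·M₀`.
-/

noncomputable section

set_option linter.dupNamespace false

namespace Summit.ValiantsHypothesis.ValiantsHypothesis.Theorems.DivisionGap.PerMultiplesHard.EventuallyExp

open Filter Topology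

/-- Polynomial versus exponential growth in `ℝ`: for every real `B` and every exponent `E`,
`B · (m+1)^E < 16 · 4^m` for all large `m`. [folklore] -/
theorem eventually_mul_succ_pow_lt (E : ℕ) (B : ℝ) :
    ∃ M₀ : ℕ, ∀ m ≥ M₀, B * ((m : ℝ) + 1) ^ E < 16 * (4 : ℝ) ^ m := by
  have ht := tendsto_pow_const_div_const_pow_of_one_lt E (show (1 : ℝ) < 4 by norm_num)
  have hev : ∀ᶠ t : ℕ in atTop, (t : ℝ) ^ E / 4 ^ t < 1 / (|B| + 1) :=
    ht.eventually (gt_mem_nhds (by positivity))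
  obtain ⟨M₀, hM₀⟩ := eventually_atTop.1 hev
  refine ⟨M₀, fun m hm => ?_⟩
  have h := hM₀ (m + 1) (Nat.le_succ_of_le hm)
  rw [div_lt_div_iff₀ (by positivity) (by positivity), one_mul] at h
  push_cast at h
  have hp : (0 : ℝ) ≤ ((m : ℝ) + 1) ^ E := by positivity
  have h4 : (0 : ℝ) < (4 : ℝ) ^ m := by positivity
  calc B * ((m : ℝ) + 1) ^ E ≤ ((m : ℝ) + 1) ^ E * (|B| + 1) := by
        nlinarith [le_abs_self B]
    _ < (4 : ℝ) ^ (m + 1) := h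
    _ = 4 * (4 : ℝ) ^ m := by rw [pow_succ, mul_comm]
    _ ≤ 16 * (4 : ℝ) ^ m := by nlinarith

/-- **Exponential beats polynomial, in the shape the composition needs.**  For `C, D ≥ 1` and
all large `n`: if `n ≤ C·a`, `a ≤ n`, `a < D·k` and `16^k ≤ (L+1)² · e^{2(C+1)} · a^{C+1}`,
then `2^{⌊n/(C·D)⌋} ≤ L`. [folklore] -/
theorem stub_eventuallyExp :
    ∀ (C D : ℕ), 1 ≤ C → 1 ≤ D → ∃ n₀ : ℕ, ∀ n ≥ n₀, ∀ (a k L : ℕ),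
      n ≤ C * a → a ≤ n → a < D * k →
      (16 : ℝ) ^ k ≤ ((L : ℝ) + 1) ^ 2 * Real.exp (2 * ((C : ℝ) + 1)) * (a : ℝ) ^ (C + 1) →
      2 ^ (n / (C * D)) ≤ L := by
  intro C D hC hD
  obtain ⟨M₀, hM₀⟩ := eventually_mul_succ_pow_lt (C + 1)
    (Real.exp (2 * ((C : ℝ) + 1)) * (((C * D : ℕ) : ℝ)) ^ (C + 1))
  have hCD : 0 < C * D := Nat.mul_pos hC hD
  refine ⟨C * D * M₀, fun n hn a k L hna han hak h16 => ?_⟩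
  set m := n / (C * D) with hm_def
  -- `m` is large
  have hM : M₀ ≤ m := by
    rw [hm_def, Nat.le_div_iff_mul_le hCD]
    calc M₀ * (C * D) = C * D * M₀ := by ring
      _ ≤ n := hn
  -- `m < k`
  have hmk : m < k := by
    rw [hm_def, Nat.div_lt_iff_lt_mul hCD]
    calc n ≤ C * a := hna
      _ < C * (D * k) := Nat.mul_lt_mul_of_pos_left hak hC
      _ = k * (C * D) := by ring
  -- `n < C·D·(m+1)`
  have hnm : n < C * D * (m + 1) := by
    rw [hm_def]
    exact Nat.lt_mul_div_succ n hCD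
  refine not_lt.1 fun hL => ?_
  -- now `L < 2^m`, i.e. `L + 1 ≤ 2^m`
  have hL1 : (L : ℝ) + 1 ≤ (2 : ℝ) ^ m := by exact_mod_cast Nat.succ_le_of_lt hL
  have h1 : ((L : ℝ) + 1) ^ 2 ≤ (4 : ℝ) ^ m := by
    calc ((L : ℝ) + 1) ^ 2 ≤ ((2 : ℝ) ^ m) ^ 2 := by gcongr
      _ = (4 : ℝ) ^ m := by rw [← pow_mul, mul_comm, pow_mul]; norm_num
  have h2 : (a : ℝ) ^ (C + 1) ≤ (((C * D : ℕ) : ℝ)) ^ (C + 1) * ((m : ℝ) + 1) ^ (C + 1) := by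
    rw [← mul_pow]
    gcongr
    have ha : (a : ℝ) ≤ n := by exact_mod_cast han
    have hn' : (n : ℝ) ≤ ((C * D : ℕ) : ℝ) * ((m : ℝ) + 1) := by exact_mod_cast hnm.le
    linarith
  have h3 : (16 : ℝ) ^ (m + 1) ≤ (16 : ℝ) ^ k := pow_le_pow_right₀ (by norm_num) hmk
  have hB := hM₀ m hM
  have h4 : (0 : ℝ) < (4 : ℝ) ^ m := by positivity
  have h16m : (16 : ℝ) ^ m = (4 : ℝ) ^ m * (4 : ℝ) ^ m := by
    rw [← mul_pow]; norm_num
  have key : (16 : ℝ) ^ (m + 1) < (16 : ℝ) ^ (m + 1) := by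
    calc (16 : ℝ) ^ (m + 1) ≤ (16 : ℝ) ^ k := h3
      _ ≤ ((L : ℝ) + 1) ^ 2 * Real.exp (2 * ((C : ℝ) + 1)) * (a : ℝ) ^ (C + 1) := h16
      _ ≤ (4 : ℝ) ^ m * Real.exp (2 * ((C : ℝ) + 1)) *
            ((((C * D : ℕ) : ℝ)) ^ (C + 1) * ((m : ℝ) + 1) ^ (C + 1)) := by
          gcongr
      _ = (4 : ℝ) ^ m * ((Real.exp (2 * ((C : ℝ) + 1)) * (((C * D : ℕ) : ℝ)) ^ (C + 1)) *
            ((m : ℝ) + 1) ^ (C + 1)) := by ring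
      _ < (4 : ℝ) ^ m * (16 * (4 : ℝ) ^ m) := by gcongr
      _ = (16 : ℝ) ^ (m + 1) := by rw [pow_succ, h16m]; ring
  exact lt_irrefl _ key

end Summit.ValiantsHypothesis.ValiantsHypothesis.Theorems.DivisionGap.PerMultiplesHard.EventuallyExp
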